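import Literature.MathematicalPhysics.KineticTheory.LangevinChainKernel
import Literature.MathematicalPhysics.KineticTheory.LangevinChainEnergyIdentity
import Literature.Probability.Process.BrownianDyadicVariation
import Mathlib.MeasureTheory.Integral.Lebesgue.Add
import HarnessLib

/-!
# The exponential supermartingale bound for the Langevin-driven pinned chain (CEHR Lemma 5.5)

Trunk T-KINETIC (Literature/MathematicalPhysics/KineticTheory). Cuneo–Eckmann–Hairer–Rey-Bellet,
EJP 23 (2018) no. 55, Lemma 5.5 and its proof (arXiv:1712.09413 p. 21): with the dissipation
integral `Γ(t) = ∑_b γ_b ∫₀ᵗ p_b²` and the martingale `M_t = ∫₀ᵗ ∑_b √(2γ_bT_b) p_b dW_b` of the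
energy identity `H(z_t) - H(z_0) = ∑_b γ_bT_b t - Γ(t) + M_t`, whose quadratic variation satisfies
`[M]_t = 2∫₀ᵗ ∑_b γ_bT_b p_b² ≤ 2 T_max Γ(t)` (5.12), "the exponential `e^{pθM_t - p²θ²[M]_t/2}` is a
Doléans–Dade exponential, and thus a supermartingale", so that its expectation is `≤ 1`. This file
PROVES that bound for the transition semigroup constructed in `LangevinChainKernel.lean` (the
pathwise flow of `LangevinChainSDE.lean` driven by the pair of Brownian motions), WITHOUT a general
theory of stochastic integration: the martingale `M_t` is the pathwise functional
`noiseWork - ½∑σ_i² t` of `LangevinChainEnergyIdentity.lean`, and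

* `pinnedChain_lintegral_exp_discreteMart_eq_one` — for the Riemann–Itô sums
  `𝔐 = ∑_k ∑_i p_i(s_k) Δ_k η_i`, `𝔔 = ∑_k ∑_i σ_i² p_i(s_k)² h` over a uniform grid the identity
  `E exp(α 𝔐 - α² 𝔔/2) = 1` holds EXACTLY (induction over the grid: the cocycle property of the
  flow, the weak Markov property of the Brownian pair `lintegral_comp_pairShift_eq`, and the Gaussian
  exponential moment `E exp(uB¹_h + vB²_h - (u²+v²)h/2) = 1`);
* `pinnedChain_ae_tendsto_discreteMart` / `pinnedChain_tendsto_discreteQV` — along the dyadic grids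
  `𝔐 → M_t` almost surely (summation by parts for the `C¹` part of the momentum, and `∑(Δη)² → σ²t`, the dyadic
  quadratic variation of Brownian motion, for `∑ η(s_k)Δ_kη = (η_t² - ∑(Δ_kη)²)/2`) and `𝔔 → [M]_t`
  for every path (Riemann sums);
* `pinnedChain_lintegral_expMart_le_one` — **`E exp(α M_t - α²[M]_t/2) ≤ 1`** (Fatou);
* `pinnedChain_lintegral_exp_hamiltonian_add_dissipation_le` — the consequence used in the proof of
  CEHR Theorem 5.1: for every `θ` and `κ = θ(1 - θ T_max)` (positive for `0 < θ < 1/T_max`),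
  **`E_x exp(θ H(z_t) + κ Γ_t) ≤ exp(θ H(x) + θγ(T_L+T_R) t)`** (energy identity, `[M] ≤ 2T_max Γ`).

The chain has `N ≥ 2` sites here (two distinct bath sites; for `N = 1` the two noises act on the
same momentum and the quadratic variation of `η_0 = c_L B¹ + c_R B²` would need the cross-variation
of the pair, which is not needed for the target).

## References

* N. Cuneo, J.-P. Eckmann, M. Hairer, L. Rey-Bellet, *Non-equilibrium steady states for networks of
  oscillators*, EJP 23 (2018) no. 55 (arXiv:1712.09413), Lemma 5.5, eqs. (5.11)–(5.12).
* D. Revuz, M. Yor, *Continuous Martingales and Brownian Motion* (1999), Ch. IV (3.23) (exponential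
  local martingales are supermartingales), Ch. IV §1 (quadratic variation as limit of sums).
* L. Rey-Bellet, L. E. Thomas, CMP 225 (2002) 305–329, Lemma 3.5 (the same Hölder/exponential
  martingale estimate).
-/

noncomputable section

open MeasureTheory ProbabilityTheory Filter Topology Set Metric Finset
open scoped NNReal ENNReal Topology

namespace Literature.MathematicalPhysics.KineticTheory.HeatConduction

open Literature.Probability.Process OscillatorChain

variable {N : ℕ}

/-! ### The noise of the pair, its variance weights, and the discrete Itô sums -/

namespace OscillatorChain

variable (P : OscillatorChain)

/-- The momentum-noise path of the chain read off a pair of raw paths, with the amplitudes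
`c_L = √(2γT_L)`, `c_R = √(2γT_R)` of (2.2) (so that `solMap t x w = chainFlow x (pairNoise w) t`).
[cite: CuneoEckmannHairerReyBellet2018, §2 eq. (2.2)] -/
def pairNoise (N : ℕ) (T_L T_R : ℝ) (w : WienerPair) : ℝ → Fin N → ℝ :=
  chainNoise N (Real.sqrt (2 * P.γ * T_L)) (Real.sqrt (2 * P.γ * T_R)) w

/-- The **variance weights** `σ_i² = [i=0] 2γT_L + [i=N-1] 2γT_R` of the noise components
(`d[η_i]_t = σ_i² dt`; CEHR (5.12): `[M]_t = 2∫₀ᵗ ∑_b γ_bT_b p_b²`).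
[cite: CuneoEckmannHairerReyBellet2018, eq. (5.12)] -/
def noiseVar (N : ℕ) (T_L T_R : ℝ) (i : Fin N) : ℝ :=
  (if i.val = 0 then 2 * P.γ * T_L else 0) + (if i.val = N - 1 then 2 * P.γ * T_R else 0)

/-- The **Riemann–Itô sum** `𝔐(h, n) = ∑_{k<n} ∑_i p_i(kh) (η_i((k+1)h) - η_i(kh))` of the martingale
`∫ ∑_i p_i dη_i` over the uniform grid of step `h`. [cite: CuneoEckmannHairerReyBellet2018, Lemma 5.5 (proof)] -/
def discreteMart (N : ℕ) (T_L T_R : ℝ) (h : ℝ) (n : ℕ) (x : PhaseSpace N) (w : WienerPair) : ℝ :=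
  ∑ k ∈ range n, ∑ i, (P.solMap N T_L T_R (k * h) x w).2 i *
    (P.pairNoise N T_L T_R w ((k + 1) * h) i - P.pairNoise N T_L T_R w (k * h) i)

/-- The **discrete quadratic variation** `𝔔(h, n) = ∑_{k<n} ∑_i σ_i² p_i(kh)² h`.
[cite: CuneoEckmannHairerReyBellet2018, eq. (5.12)] -/
def discreteQV (N : ℕ) (T_L T_R : ℝ) (h : ℝ) (n : ℕ) (x : PhaseSpace N) (w : WienerPair) : ℝ :=
  ∑ k ∈ range n, ∑ i, P.noiseVar N T_L T_R i * (P.solMap N T_L T_R (k * h) x w).2 i ^ 2 * h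

/-- The **martingale part of the energy** `M_t = 𝓜_t - ½ (∑_i σ_i²) t` (the work of the noise minus
its compensator; CEHR: `M_t = ∫₀ᵗ ∑_b √(2γ_bT_b) p_b dW_b`), a pathwise functional.
[cite: CuneoEckmannHairerReyBellet2018, Lemma 5.5 (proof)] -/
def energyMart (N : ℕ) (T_L T_R : ℝ) (t : ℝ) (x : PhaseSpace N) (w : WienerPair) : ℝ :=
  P.noiseWork N x (P.pairNoise N T_L T_R w) t - (∑ i, P.noiseVar N T_L T_R i) * t / 2

/-- Its **quadratic variation** `[M]_t = ∑_i σ_i² ∫₀ᵗ p_i(s)² ds` (CEHR (5.12)).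
[cite: CuneoEckmannHairerReyBellet2018, eq. (5.12)] -/
def energyQV (N : ℕ) (T_L T_R : ℝ) (t : ℝ) (x : PhaseSpace N) (w : WienerPair) : ℝ :=
  ∑ i, P.noiseVar N T_L T_R i * ∫ s in (0 : ℝ)..t, (P.solMap N T_L T_R s x w).2 i ^ 2

/-- `solMap` is the flow driven by `pairNoise`. [folklore] -/
theorem solMap_eq_chainFlow (N : ℕ) (T_L T_R : ℝ) (t : ℝ) (x : PhaseSpace N) (w : WienerPair) :
    P.solMap N T_L T_R t x w = P.chainFlow N x (P.pairNoise N T_L T_R w) t := rfl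

/-- The noise of the pair is continuous in time. [folklore] -/
theorem continuous_pairNoise (N : ℕ) (T_L T_R : ℝ) (w : WienerPair) : Continuous (P.pairNoise N T_L T_R w) :=
  continuous_chainNoise _ _ w

/-- The noise of the pair at a fixed time is measurable in the pair. [folklore] -/
theorem measurable_pairNoise (N : ℕ) (T_L T_R : ℝ) (t : ℝ) : Measurable fun w => P.pairNoise N T_L T_R w t :=
  measurable_chainNoise _ _ t

/-- `η(0) = 0`. [folklore] -/
@[simp] theorem pairNoise_zero (N : ℕ) (T_L T_R : ℝ) (w : WienerPair) : P.pairNoise N T_L T_R w 0 = 0 :=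
  chainNoise_zero _ _ w

/-- The noise of the Brownian pair: `η_i(t) = [i=0] c_L B¹_{t⁺} + [i=N-1] c_R B²_{t⁺}`. [folklore] -/
theorem pairNoise_pairPath (N : ℕ) (T_L T_R : ℝ) (ω : WienerPair) (t : ℝ) (i : Fin N) :
    P.pairNoise N T_L T_R (pairPath ω) t i =
      (if i.val = 0 then Real.sqrt (2 * P.γ * T_L) else 0) * brownian t.toNNReal ω.1 +
        (if i.val = N - 1 then Real.sqrt (2 * P.γ * T_R) else 0) * brownian t.toNNReal ω.2 :=
  chainNoise_pairPath _ _ ω t i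

/-- The noise of the shifted pair is the shifted noise (on `t ≥ 0`). [folklore] -/
theorem pairNoise_pairShift (N : ℕ) (T_L T_R : ℝ) (s : ℝ≥0) (ω : WienerPair) {t : ℝ} (ht : 0 ≤ t) :
    P.pairNoise N T_L T_R (pairShift s ω) t =
      P.pairNoise N T_L T_R (pairPath ω) (s + t) - P.pairNoise N T_L T_R (pairPath ω) s :=
  chainNoise_pairShift _ _ s ω ht

/-- The variance weights are nonnegative (`γ, T_L, T_R ≥ 0`). [folklore] -/
theorem noiseVar_nonneg (hγ : 0 ≤ P.γ) {T_L T_R : ℝ} (hL : 0 ≤ T_L) (hR : 0 ≤ T_R) (i : Fin N) :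
    0 ≤ P.noiseVar N T_L T_R i := by
  unfold noiseVar
  refine add_nonneg ?_ ?_ <;> split_ifs <;> positivity

/-- `σ_i² ≤ 2γ T_max w_i` with `T_max = max(T_L, T_R)` and the bath weights `w_i` (`γ ≥ 0`).
[cite: CuneoEckmannHairerReyBellet2018, eq. (5.12)] -/
theorem noiseVar_le (hγ : 0 ≤ P.γ) (T_L T_R : ℝ) (i : Fin N) :
    P.noiseVar N T_L T_R i ≤ 2 * P.γ * max T_L T_R * bathWeight N i := by
  unfold noiseVar bathWeight
  have h1 : (if i.val = 0 then 2 * P.γ * T_L else 0) ≤ 2 * P.γ * max T_L T_R * (if i.val = 0 then 1 else 0) := by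
    split_ifs
    · rw [mul_one]; exact mul_le_mul_of_nonneg_left (le_max_left _ _) (by positivity)
    · simp
  have h2 : (if i.val = N - 1 then 2 * P.γ * T_R else 0) ≤ 2 * P.γ * max T_L T_R * (if i.val = N - 1 then 1 else 0) := by
    split_ifs
    · rw [mul_one]; exact mul_le_mul_of_nonneg_left (le_max_right _ _) (by positivity)
    · simp
  calc _ ≤ 2 * P.γ * max T_L T_R * (if i.val = 0 then 1 else 0) +
        2 * P.γ * max T_L T_R * (if i.val = N - 1 then 1 else 0) := add_le_add h1 h2
    _ = _ := by ring

/-- `∑_i σ_i² = 2γ(T_L + T_R)` for `N ≥ 1` (both for `N ≥ 2`, two bath sites, and `N = 1`). [folklore] -/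
theorem sum_noiseVar (hN : 0 < N) (T_L T_R : ℝ) : ∑ i : Fin N, P.noiseVar N T_L T_R i = 2 * P.γ * (T_L + T_R) := by
  unfold noiseVar
  rw [sum_add_distrib]
  have h1 : ∑ i : Fin N, (if i.val = 0 then 2 * P.γ * T_L else 0) = 2 * P.γ * T_L := by
    rw [Finset.sum_eq_single_of_mem (⟨0, hN⟩ : Fin N) (mem_univ _)]
    · simp
    · intro b _ hb
      rw [if_neg]
      exact fun h => hb (Fin.ext h)
  have h2 : ∑ i : Fin N, (if i.val = N - 1 then 2 * P.γ * T_R else 0) = 2 * P.γ * T_R := by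
    rw [Finset.sum_eq_single_of_mem (⟨N - 1, by omega⟩ : Fin N) (mem_univ _)]
    · simp
    · intro b _ hb
      rw [if_neg]
      exact fun h => hb (Fin.ext h)
  rw [h1, h2]
  ring

end OscillatorChain

/-! ### The exact exponential identity for the discrete Itô sums -/

section Discrete

variable {ω₂ lam β γ : ℝ} (hω : 0 < ω₂) (hl : 0 ≤ lam) (hβ : 0 ≤ β) (hγ : 0 ≤ γ) (N : ℕ)
  {T_L T_R : ℝ} (hTL : 0 ≤ T_L) (hTR : 0 ≤ T_R)
include hω hl hβ hγ

/-- One step of the grid: `𝔐(h, n+1, x, B(ω)) = ∑_i x_{p,i} η_i(h)(ω) + 𝔐(h, n, Φ_h(x, B(ω)), θ_h ω)`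
(the cocycle property of the flow and `η(θ_h ω)(t) = η(ω)(h + t) - η(ω)(h)`). [folklore] -/
theorem pinnedChain_discreteMart_succ {h : ℝ} (hh : 0 ≤ h) (n : ℕ) (x : PhaseSpace N) (ω : WienerPair) :
    (pinnedChain ω₂ lam β γ).discreteMart N T_L T_R h (n + 1) x (pairPath ω) =
      (∑ i, x.2 i * (pinnedChain ω₂ lam β γ).pairNoise N T_L T_R (pairPath ω) h i) +
        (pinnedChain ω₂ lam β γ).discreteMart N T_L T_R h n
          ((pinnedChain ω₂ lam β γ).solMap N T_L T_R h x (pairPath ω)) (pairShift h.toNNReal ω) := by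
  set P := pinnedChain ω₂ lam β γ with hP
  unfold OscillatorChain.discreteMart
  rw [sum_range_succ']
  simp only [Nat.cast_zero, zero_mul, zero_add, one_mul, Nat.cast_succ]
  rw [add_comm]
  congr 1
  · -- the `k = 0` term: `Φ_0 = id`, `η(0) = 0`
    refine sum_congr rfl fun i _ => ?_
    rw [pinnedChain_solMap_of_nonpos N T_L T_R x _ le_rfl, P.pairNoise_zero]
    simp
  · -- the `k + 1` terms: cocycle and shifted noise
    refine sum_congr rfl fun k _ => sum_congr rfl fun i _ => ?_
    have hk : (0 : ℝ) ≤ k * h := by positivity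
    have hk1 : (0 : ℝ) ≤ (k + 1) * h := by positivity
    have hc : ((h.toNNReal : ℝ≥0) : ℝ) = h := Real.coe_toNNReal h hh
    have hZ : P.solMap N T_L T_R ((k + 1) * h) x (pairPath ω) =
        P.solMap N T_L T_R (k * h) (P.solMap N T_L T_R h x (pairPath ω)) (pairShift h.toNNReal ω) := by
      have := pinnedChain_solMap_add_pairPath hω hl hβ hγ N T_L T_R h.toNNReal hk x ω
      rw [hc] at this
      rw [← this]
      congr 1
      ring
    have hη : ∀ {u : ℝ}, 0 ≤ u → P.pairNoise N T_L T_R (pairShift h.toNNReal ω) u =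
        P.pairNoise N T_L T_R (pairPath ω) (h + u) - P.pairNoise N T_L T_R (pairPath ω) h := by
      intro u hu
      have := P.pairNoise_pairShift N T_L T_R h.toNNReal ω hu
      rwa [hc] at this
    have e2 : ((k : ℝ) + 1 + 1) * h = h + (k + 1) * h := by ring
    have e1 : ((k : ℝ) + 1) * h = h + k * h := by ring
    rw [hZ, hη hk1, hη hk, e2]
    simp only [Pi.sub_apply]
    rw [e1]
    ring

/-- One step of the grid for the discrete quadratic variation. [folklore] -/
theorem pinnedChain_discreteQV_succ {h : ℝ} (hh : 0 ≤ h) (n : ℕ) (x : PhaseSpace N) (ω : WienerPair) :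
    (pinnedChain ω₂ lam β γ).discreteQV N T_L T_R h (n + 1) x (pairPath ω) =
      (∑ i, (pinnedChain ω₂ lam β γ).noiseVar N T_L T_R i * x.2 i ^ 2 * h) +
        (pinnedChain ω₂ lam β γ).discreteQV N T_L T_R h n
          ((pinnedChain ω₂ lam β γ).solMap N T_L T_R h x (pairPath ω)) (pairShift h.toNNReal ω) := by
  set P := pinnedChain ω₂ lam β γ with hP
  unfold OscillatorChain.discreteQV
  rw [sum_range_succ']
  simp only [Nat.cast_zero, zero_mul, Nat.cast_succ]
  rw [add_comm]
  congr 1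
  · refine sum_congr rfl fun i _ => ?_
    rw [pinnedChain_solMap_of_nonpos N T_L T_R x _ le_rfl]
  · refine sum_congr rfl fun k _ => sum_congr rfl fun i _ => ?_
    have hk : (0 : ℝ) ≤ k * h := by positivity
    have hc : ((h.toNNReal : ℝ≥0) : ℝ) = h := Real.coe_toNNReal h hh
    have hZ : P.solMap N T_L T_R ((k + 1) * h) x (pairPath ω) =
        P.solMap N T_L T_R (k * h) (P.solMap N T_L T_R h x (pairPath ω)) (pairShift h.toNNReal ω) := by
      have := pinnedChain_solMap_add_pairPath hω hl hβ hγ N T_L T_R h.toNNReal hk x ω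
      rw [hc] at this
      rw [← this]
      congr 1
      ring
    rw [hZ]

/-- The discrete sums are jointly measurable in `(x, w)`. [folklore] -/
theorem pinnedChain_measurable_discreteMart (h : ℝ) (n : ℕ) :
    Measurable fun p : PhaseSpace N × WienerPair =>
      (pinnedChain ω₂ lam β γ).discreteMart N T_L T_R h n p.1 p.2 := by
  unfold OscillatorChain.discreteMart
  refine Finset.measurable_sum _ fun k _ => Finset.measurable_sum _ fun i _ => ?_
  have h1 : Measurable fun p : PhaseSpace N × WienerPair =>
      ((pinnedChain ω₂ lam β γ).solMap N T_L T_R (k * h) p.1 p.2).2 i :=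
    (measurable_pi_apply i).comp (measurable_snd.comp (pinnedChain_measurable_solMap hω hl hβ hγ N T_L T_R _))
  have h2 : ∀ t, Measurable fun p : PhaseSpace N × WienerPair => (pinnedChain ω₂ lam β γ).pairNoise N T_L T_R p.2 t i :=
    fun t => (measurable_pi_apply i).comp (((pinnedChain ω₂ lam β γ).measurable_pairNoise N T_L T_R t).comp measurable_snd)
  exact h1.mul ((h2 _).sub (h2 _))

/-- The discrete quadratic variation is jointly measurable in `(x, w)`. [folklore] -/
theorem pinnedChain_measurable_discreteQV (h : ℝ) (n : ℕ) :
    Measurable fun p : PhaseSpace N × WienerPair =>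
      (pinnedChain ω₂ lam β γ).discreteQV N T_L T_R h n p.1 p.2 := by
  unfold OscillatorChain.discreteQV
  refine Finset.measurable_sum _ fun k _ => Finset.measurable_sum _ fun i _ => ?_
  have h1 : Measurable fun p : PhaseSpace N × WienerPair =>
      ((pinnedChain ω₂ lam β γ).solMap N T_L T_R (k * h) p.1 p.2).2 i :=
    (measurable_pi_apply i).comp (measurable_snd.comp (pinnedChain_measurable_solMap hω hl hβ hγ N T_L T_R _))
  exact ((h1.pow_const 2).const_mul _).mul_const _

include hTL hTR in
omit hω hl hβ in
/-- **The Gaussian step**: `E exp(α ∑_i x_{p,i} η_i(h) - α²/2 ∑_i σ_i² x_{p,i}² h) = 1` — the linear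
functional `∑_i x_{p,i} η_i(h) = (c_L x_{p,0}) B¹_h + (c_R x_{p,N-1}) B²_h` of the pair at time `h` and
`∑_i σ_i² x_{p,i}² = (c_L x_{p,0})² + (c_R x_{p,N-1})²` (`N ≥ 1`; `lintegral_exp_linear_pair_sub`).
[folklore] -/
theorem pinnedChain_lintegral_exp_linear_noise (hN : 0 < N) (α : ℝ) {h : ℝ} (hh : 0 ≤ h) (x : PhaseSpace N) :
    ∫⁻ ω, ENNReal.ofReal (Real.exp (α * ∑ i, x.2 i * (pinnedChain ω₂ lam β γ).pairNoise N T_L T_R (pairPath ω) h i -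
        α ^ 2 / 2 * ∑ i, (pinnedChain ω₂ lam β γ).noiseVar N T_L T_R i * x.2 i ^ 2 * h)) ∂wienerPair = 1 := by
  set P := pinnedChain ω₂ lam β γ with hP
  set cL := Real.sqrt (2 * P.γ * T_L) with hcL
  set cR := Real.sqrt (2 * P.γ * T_R) with hcR
  have hγ' : P.γ = γ := rfl
  have hcL2 : cL ^ 2 = 2 * P.γ * T_L := Real.sq_sqrt (by rw [hγ']; positivity)
  have hcR2 : cR ^ 2 = 2 * P.γ * T_R := Real.sq_sqrt (by rw [hγ']; positivity)
  set i₀ : Fin N := ⟨0, hN⟩ with hi₀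
  set i₁ : Fin N := ⟨N - 1, by omega⟩ with hi₁
  -- the linear functional of the pair at time `h`
  have hlin : ∀ ω : WienerPair, ∑ i, x.2 i * P.pairNoise N T_L T_R (pairPath ω) h i =
      (cL * x.2 i₀) * brownian h.toNNReal ω.1 + (cR * x.2 i₁) * brownian h.toNNReal ω.2 := by
    intro ω
    simp only [P.pairNoise_pairPath, mul_add, sum_add_distrib]
    congr 1
    · rw [Finset.sum_eq_single_of_mem i₀ (mem_univ _)]
      · simp [hi₀, hcL]; ring
      · intro b _ hb
        rw [if_neg, zero_mul, mul_zero]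
        exact fun h => hb (Fin.ext h)
    · rw [Finset.sum_eq_single_of_mem i₁ (mem_univ _)]
      · simp [hi₁, hcR]; ring
      · intro b _ hb
        rw [if_neg, zero_mul, mul_zero]
        exact fun h => hb (Fin.ext h)
  -- the matching variance
  have hvar : ∑ i, P.noiseVar N T_L T_R i * x.2 i ^ 2 * h = ((cL * x.2 i₀) ^ 2 + (cR * x.2 i₁) ^ 2) * h := by
    unfold OscillatorChain.noiseVar
    simp only [add_mul, sum_add_distrib]
    rw [Finset.sum_eq_single_of_mem i₀ (mem_univ _) (fun b _ hb => by rw [if_neg (fun h => hb (Fin.ext h))]; ring),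
      Finset.sum_eq_single_of_mem i₁ (mem_univ _) (fun b _ hb => by rw [if_neg (fun h => hb (Fin.ext h))]; ring)]
    simp only [hi₀, hi₁, if_true]
    rw [mul_pow, mul_pow, hcL2, hcR2]
  simp_rw [hlin, hvar]
  have := lintegral_exp_linear_pair_sub h.toNNReal (α * (cL * x.2 i₀)) (α * (cR * x.2 i₁))
  rw [Real.coe_toNNReal h hh] at this
  exact (lintegral_congr fun ω => by (congr 2; ring)).trans this

omit hω hl hβ hγ in
/-- The noise at time `h` read off the Brownian pair is measurable with respect to the past of the
pair up to time `h`. [folklore] -/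
theorem pinnedChain_measurable_comap_pairPast_pairNoise (h : ℝ) :
    Measurable[MeasurableSpace.comap (pairPast h.toNNReal) inferInstance]
      fun ω : WienerPair => (pinnedChain ω₂ lam β γ).pairNoise N T_L T_R (pairPath ω) h := by
  set P := pinnedChain ω₂ lam β γ with hP
  set g : (Set.Iic h.toNNReal → ℝ) × (Set.Iic h.toNNReal → ℝ) → Fin N → ℝ := fun q i =>
    (if i.val = 0 then Real.sqrt (2 * P.γ * T_L) else 0) * q.1 ⟨h.toNNReal, Set.self_mem_Iic⟩ +
      (if i.val = N - 1 then Real.sqrt (2 * P.γ * T_R) else 0) * q.2 ⟨h.toNNReal, Set.self_mem_Iic⟩ with hg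
  have hgm : Measurable g := by
    refine measurable_pi_iff.2 fun i => ?_
    exact (((measurable_pi_apply _).comp measurable_fst).const_mul _).add
      (((measurable_pi_apply _).comp measurable_snd).const_mul _)
  have hfun : (fun ω : WienerPair => P.pairNoise N T_L T_R (pairPath ω) h) = g ∘ pairPast h.toNNReal := by
    funext ω i
    simp only [hg, Function.comp_apply, P.pairNoise_pairPath, pairPast_fst_apply, pairPast_snd_apply]
  rw [hfun]
  exact hgm.comp (comap_measurable (pairPast h.toNNReal))

include hTL hTR in
/-- **The exact exponential identity for the Riemann–Itô sums** (the discrete Doléans–Dade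
martingale has expectation one): for every step `h ≥ 0`, every number of steps `n` and every
start `x`, `E exp(α 𝔐(h,n,x) - α²/2 𝔔(h,n,x)) = 1`. Induction on `n`: split off the first step
(`pinnedChain_discreteMart_succ`), factorise the expectation at time `h` by the weak Markov
property of the pair (`lintegral_comp_pairShift_eq`; the state `Φ_h(x, B)` and `η(h)` are
measurable with respect to the past), apply the induction hypothesis from the new state, and
finish with the Gaussian step. [cite: CuneoEckmannHairerReyBellet2018, Lemma 5.5 (proof)] -/
theorem pinnedChain_lintegral_exp_discreteMart_eq_one (hN : 0 < N) (α : ℝ) {h : ℝ} (hh : 0 ≤ h) :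
    ∀ (n : ℕ) (x : PhaseSpace N),
      ∫⁻ ω, ENNReal.ofReal (Real.exp (α * (pinnedChain ω₂ lam β γ).discreteMart N T_L T_R h n x (pairPath ω) -
          α ^ 2 / 2 * (pinnedChain ω₂ lam β γ).discreteQV N T_L T_R h n x (pairPath ω))) ∂wienerPair = 1
  | 0, x => by simp [OscillatorChain.discreteMart, OscillatorChain.discreteQV]
  | n + 1, x => by
    set P := pinnedChain ω₂ lam β γ with hP
    have ih := pinnedChain_lintegral_exp_discreteMart_eq_one hN α hh n
    -- the two factors
    set g : (Fin N → ℝ) → ℝ≥0∞ := fun e => ENNReal.ofReal (Real.exp (α * ∑ i, x.2 i * e i -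
      α ^ 2 / 2 * ∑ i, P.noiseVar N T_L T_R i * x.2 i ^ 2 * h)) with hg
    set F : PhaseSpace N × WienerPair → ℝ≥0∞ := fun p => ENNReal.ofReal (Real.exp
      (α * P.discreteMart N T_L T_R h n p.1 p.2 - α ^ 2 / 2 * P.discreteQV N T_L T_R h n p.1 p.2)) with hF
    set G : ((Fin N → ℝ) × PhaseSpace N) × WienerPair → ℝ≥0∞ := fun p => g p.1.1 * F (p.1.2, p.2) with hG
    have hgm : Measurable g := by
      refine ENNReal.measurable_ofReal.comp (Real.measurable_exp.comp ?_)
      exact ((Finset.measurable_sum _ fun i _ => (measurable_pi_apply i).const_mul _).const_mul _).sub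
        measurable_const
    have hFm : Measurable F := ENNReal.measurable_ofReal.comp (Real.measurable_exp.comp
      (((pinnedChain_measurable_discreteMart hω hl hβ hγ N h n).const_mul _).sub
        ((pinnedChain_measurable_discreteQV hω hl hβ hγ N h n).const_mul _)))
    have hGm : Measurable G :=
      (hgm.comp (measurable_fst.comp measurable_fst)).mul
        (hFm.comp ((measurable_snd.comp measurable_fst).prodMk measurable_snd))
    -- the past-measurable data at time `h`
    set ξ : WienerPair → (Fin N → ℝ) × PhaseSpace N := fun ω =>
      (P.pairNoise N T_L T_R (pairPath ω) h, P.solMap N T_L T_R h x (pairPath ω)) with hξ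
    have hξm : Measurable[MeasurableSpace.comap (pairPast h.toNNReal) inferInstance] ξ := by
      refine Measurable.prodMk (pinnedChain_measurable_comap_pairPast_pairNoise N h) ?_
      have := pinnedChain_measurable_comap_pairPast_solMap hω hl hβ hγ N T_L T_R h.toNNReal x
      rwa [Real.coe_toNNReal h hh] at this
    -- rewrite the integrand as `G(ξ ω, θ_h ω)`
    have hint : ∀ ω, ENNReal.ofReal (Real.exp (α * P.discreteMart N T_L T_R h (n + 1) x (pairPath ω) -
        α ^ 2 / 2 * P.discreteQV N T_L T_R h (n + 1) x (pairPath ω))) = G (ξ ω, pairShift h.toNNReal ω) := by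
      intro ω
      rw [pinnedChain_discreteMart_succ hω hl hβ hγ N hh, pinnedChain_discreteQV_succ hω hl hβ hγ N hh]
      simp only [hG, hg, hF, hξ]
      rw [← ENNReal.ofReal_mul (Real.exp_pos _).le, ← Real.exp_add]
      congr 2
      ring
    simp_rw [hint]
    rw [lintegral_comp_pairShift_eq h.toNNReal hξm hGm]
    -- inner integral: the induction hypothesis from the new state
    have hinner : ∀ ω, ∫⁻ ω', G (ξ ω, pairPath ω') ∂wienerPair = g (ξ ω).1 := by
      intro ω
      simp only [hG]
      rw [lintegral_const_mul (g (ξ ω).1) (f := fun ω' => F ((ξ ω).2, pairPath ω'))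
        (hFm.comp (measurable_const.prodMk measurable_pairPath))]
      simp only [hF, hξ]
      rw [ih, mul_one]
    simp_rw [hinner]
    simp only [hξ, hg]
    exact pinnedChain_lintegral_exp_linear_noise hγ N hTL hTR hN α hh x

end Discrete

/-! ### Riemann sums with tags, for continuous functions -/

section Riemann

/-- **Tagged Riemann–Stieltjes sums of continuous functions converge**: for `φ, g` continuous and
tags `τ_{n,k}` in the `k`-th cell of the uniform grid of `[0, t]` with `n` cells,
`∑_{k<n} φ(τ_{n,k}) ∫_{cell k} g → ∫₀ᵗ φ g` as `n → ∞` (uniform continuity of `φ` on `[0, t]`).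
[folklore] -/
theorem tendsto_sum_mul_integral_of_continuous {φ g : ℝ → ℝ} (hφ : Continuous φ) (hg : Continuous g)
    {t : ℝ} (ht : 0 ≤ t) (τ : ℕ → ℕ → ℝ)
    (hτ : ∀ n k : ℕ, k < n → (k : ℝ) * (t / n) ≤ τ n k ∧ τ n k ≤ ((k : ℝ) + 1) * (t / n)) :
    Tendsto (fun n : ℕ => ∑ k ∈ range n, φ (τ n k) * ∫ s in (k * (t / n))..((k + 1) * (t / n)), g s) atTop
      (𝓝 (∫ s in (0 : ℝ)..t, φ s * g s)) := by
  -- a bound for `g` on `[0, t]`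
  obtain ⟨B, hB⟩ := isCompact_Icc.exists_bound_of_continuousOn (hg.continuousOn (s := Icc 0 t))
  have hB0 : 0 ≤ B := (norm_nonneg _).trans (hB 0 ⟨le_rfl, ht⟩)
  rw [Metric.tendsto_atTop]
  intro ε hε
  -- uniform continuity of `φ` on `[0, t]`
  have huc := isCompact_Icc.uniformContinuousOn_of_continuous (hφ.continuousOn (s := Icc (0 : ℝ) t))
  rw [Metric.uniformContinuousOn_iff] at huc
  set ε' : ℝ := ε / (2 * (B + 1) * (t + 1)) with hε'
  have hε'0 : 0 < ε' := by positivity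
  obtain ⟨δ, hδ0, hδ⟩ := huc ε' hε'0
  obtain ⟨n₀, hn₀⟩ := exists_nat_gt (t / δ)
  refine ⟨n₀ + 1, fun n hn => ?_⟩
  have hn0 : 0 < n := by omega
  have hnr : (0 : ℝ) < n := Nat.cast_pos.2 hn0
  have hh : t / n < δ := by
    rcases eq_or_lt_of_le ht with h0 | h0
    · rw [← h0, zero_div]; exact hδ0
    · rw [div_lt_iff₀ hnr]
      have : t / δ < n := hn₀.trans (by exact_mod_cast (by omega : n₀ < n))
      rw [div_lt_iff₀ hδ0] at this
      linarith
  have hcell : ∀ k : ℕ, (k : ℝ) * (t / n) ≤ (k + 1) * (t / n) := fun k =>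
    mul_le_mul_of_nonneg_right (by linarith) (by positivity)
  have hcellt : ∀ k : ℕ, k < n → ((k : ℝ) + 1) * (t / n) ≤ t := fun k hk => by
    have : ((k : ℝ) + 1) ≤ n := by exact_mod_cast hk
    calc ((k : ℝ) + 1) * (t / n) ≤ n * (t / n) := mul_le_mul_of_nonneg_right this (by positivity)
      _ = t := mul_div_cancel₀ _ hnr.ne'
  -- the integral as a sum over the cells
  have hsum : ∫ s in (0 : ℝ)..t, φ s * g s =
      ∑ k ∈ range n, ∫ s in (k * (t / n))..((k + 1) * (t / n)), φ s * g s := by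
    have := intervalIntegral.sum_integral_adjacent_intervals (f := fun s => φ s * g s) (μ := volume)
      (a := fun k : ℕ => (k : ℝ) * (t / n)) (n := n) fun k _ =>
        (hφ.mul hg : Continuous fun s => φ s * g s).intervalIntegrable _ _
    simp only [Nat.cast_zero, zero_mul] at this
    rw [mul_div_cancel₀ _ hnr.ne'] at this
    rw [← this]
    refine sum_congr rfl fun k _ => ?_
    simp only [Nat.cast_succ]
  rw [hsum, dist_eq_norm, ← sum_sub_distrib]
  -- each cell contributes at most `ε' B (t/n)`
  have hterm : ∀ k ∈ range n, ‖φ (τ n k) * (∫ s in (k * (t / n))..((k + 1) * (t / n)), g s) -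
      ∫ s in (k * (t / n))..((k + 1) * (t / n)), φ s * g s‖ ≤ ε' * B * (t / n) := by
    intro k hk
    have hk' := mem_range.1 hk
    have hI1 : IntervalIntegrable (fun s => φ (τ n k) * g s) volume (k * (t / n)) ((k + 1) * (t / n)) :=
      (hg.intervalIntegrable _ _).const_mul _
    have hI2 : IntervalIntegrable (fun s => φ s * g s) volume (k * (t / n)) ((k + 1) * (t / n)) :=
      (hφ.mul hg).intervalIntegrable _ _
    rw [← intervalIntegral.integral_const_mul, ← intervalIntegral.integral_sub hI1 hI2]
    have hle := intervalIntegral.norm_integral_le_of_norm_le_const (a := (k : ℝ) * (t / n))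
      (b := ((k : ℝ) + 1) * (t / n)) (f := fun s => φ (τ n k) * g s - φ s * g s) (C := ε' * B) ?_
    · refine hle.trans (le_of_eq ?_)
      rw [show ((k : ℝ) + 1) * (t / n) - k * (t / n) = t / n by ring, abs_of_nonneg (by positivity)]
    · intro s hs
      rw [uIoc_of_le (hcell k)] at hs
      have hs' : s ∈ Icc (0 : ℝ) t := ⟨le_trans (by positivity) hs.1.le, hs.2.trans (hcellt k hk')⟩
      have hτk := hτ n k hk'
      have hτ' : τ n k ∈ Icc (0 : ℝ) t := ⟨le_trans (by positivity) hτk.1, hτk.2.trans (hcellt k hk')⟩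
      have hdist : dist (τ n k) s < δ := by
        rw [Real.dist_eq, abs_lt]
        constructor <;> nlinarith [hs.1, hs.2, hτk.1, hτk.2, hh]
      have h1 := hδ _ hτ' _ hs' hdist
      rw [Real.dist_eq] at h1
      rw [← sub_mul, norm_mul, Real.norm_eq_abs, Real.norm_eq_abs]
      exact mul_le_mul h1.le (by simpa using hB s hs') (abs_nonneg _) hε'0.le
  calc ‖∑ k ∈ range n, (φ (τ n k) * (∫ s in (k * (t / n))..((k + 1) * (t / n)), g s) -
        ∫ s in (k * (t / n))..((k + 1) * (t / n)), φ s * g s)‖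
      ≤ ∑ k ∈ range n, ε' * B * (t / n) := (norm_sum_le _ _).trans (sum_le_sum hterm)
    _ = ε' * B * t := by
        rw [sum_const, card_range, nsmul_eq_mul]
        field_simp
    _ < ε := by
        rw [hε']
        have h1 : B * t < (B + 1) * (t + 1) * 2 := by nlinarith
        have h2 : 0 < 2 * (B + 1) * (t + 1) := by positivity
        rw [div_mul_eq_mul_div, div_mul_eq_mul_div, div_lt_iff₀ h2]
        nlinarith

/-- **Left Riemann sums of a continuous function converge**: `∑_{k<n} g(k t/n) (t/n) → ∫₀ᵗ g`.
[folklore] -/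
theorem tendsto_riemannSum_of_continuous {g : ℝ → ℝ} (hg : Continuous g) {t : ℝ} (ht : 0 ≤ t) :
    Tendsto (fun n : ℕ => ∑ k ∈ range n, g (k * (t / n)) * (t / n)) atTop (𝓝 (∫ s in (0 : ℝ)..t, g s)) := by
  have h := tendsto_sum_mul_integral_of_continuous hg continuous_const (g := fun _ => (1 : ℝ)) ht
    (fun n k => (k : ℝ) * (t / n)) fun n k _ => ⟨le_rfl, mul_le_mul_of_nonneg_right (by linarith) (by positivity)⟩
  simp only [mul_one, intervalIntegral.integral_const, smul_eq_mul] at h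
  refine h.congr fun n => sum_congr rfl fun k _ => ?_
  ring

end Riemann

/-! ### Two summation identities -/

section Abel

/-- **Summation by parts**: `∑_{k<n} A_k (η_{k+1} - η_k) = A_n η_n - A_0 η_0 - ∑_{k<n} η_{k+1}(A_{k+1} - A_k)`.
[folklore] -/
theorem sum_mul_sub_eq_abel (A η : ℕ → ℝ) (n : ℕ) :
    ∑ k ∈ range n, A k * (η (k + 1) - η k) =
      A n * η n - A 0 * η 0 - ∑ k ∈ range n, η (k + 1) * (A (k + 1) - A k) := by
  induction n with
  | zero => simp
  | succ n ih =>
    rw [sum_range_succ, sum_range_succ, ih]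
    ring

/-- **The Itô sum of a path against itself**: `∑_{k<n} η_k (η_{k+1} - η_k) =
(η_n² - η_0² - ∑_{k<n} (η_{k+1} - η_k)²)/2`. [folklore] -/
theorem sum_mul_sub_self_eq (η : ℕ → ℝ) (n : ℕ) :
    ∑ k ∈ range n, η k * (η (k + 1) - η k) =
      (η n ^ 2 - η 0 ^ 2 - ∑ k ∈ range n, (η (k + 1) - η k) ^ 2) / 2 := by
  induction n with
  | zero => simp
  | succ n ih =>
    rw [sum_range_succ, sum_range_succ, ih]
    ring

/-- The grid of `discreteMart` matches the grid of `brownianQuadSum`: for `t ≥ 0`,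
`(k t/n)⁺ = gridTime t⁺ n k`. [folklore] -/
theorem toNNReal_mul_div_eq_gridTime {t : ℝ} (ht : 0 ≤ t) (n k : ℕ) :
    ((k : ℝ) * (t / n)).toNNReal = gridTime t.toNNReal n k := by
  have h : ((gridTime t.toNNReal n k : ℝ≥0) : ℝ) = (k : ℝ) * (t / n) := by
    simp [gridTime, Real.coe_toNNReal t ht]
  rw [← h, Real.toNNReal_coe]

end Abel

/-! ### Convergence of the discrete sums along the dyadic grids -/

section Limit

variable {ω₂ lam β γ : ℝ} (hω : 0 < ω₂) (hl : 0 ≤ lam) (hβ : 0 ≤ β) (hγ : 0 ≤ γ) (N : ℕ)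
  (T_L T_R : ℝ)
include hω hl hβ hγ

/-- **The discrete quadratic variation converges to `[M]_t` for every path** (left Riemann sums of
the continuous functions `p_i(s)²`). [cite: CuneoEckmannHairerReyBellet2018, eq. (5.12)] -/
theorem pinnedChain_tendsto_discreteQV {t : ℝ} (ht : 0 ≤ t) (x : PhaseSpace N) (w : WienerPair) :
    Tendsto (fun n : ℕ => (pinnedChain ω₂ lam β γ).discreteQV N T_L T_R (t / n) n x w) atTop
      (𝓝 ((pinnedChain ω₂ lam β γ).energyQV N T_L T_R t x w)) := by
  set P := pinnedChain ω₂ lam β γ with hP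
  have hcont : ∀ i, Continuous fun s => (P.solMap N T_L T_R s x w).2 i ^ 2 := fun i =>
    ((continuous_apply i).comp (continuous_snd.comp (pinnedChain_continuous_solMap hω hl hβ hγ N T_L T_R x w))).pow 2
  have hswap : ∀ n : ℕ, P.discreteQV N T_L T_R (t / n) n x w =
      ∑ i, P.noiseVar N T_L T_R i * ∑ k ∈ range n, (P.solMap N T_L T_R (k * (t / n)) x w).2 i ^ 2 * (t / n) := by
    intro n
    unfold OscillatorChain.discreteQV
    rw [sum_comm]
    refine sum_congr rfl fun i _ => ?_
    rw [mul_sum]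
    exact sum_congr rfl fun k _ => by ring
  simp_rw [hswap]
  unfold OscillatorChain.energyQV
  refine tendsto_finsetSum _ fun i _ => ?_
  exact (tendsto_riemannSum_of_continuous (hcont i) ht).const_mul _

/-- **The Riemann–Itô sums converge to `M_t` almost surely along the dyadic grids** (`N ≥ 2`):
for each component, `p_i = A_i + η_i` with `A_i ∈ C¹`; `∑ A_i(s_k)Δ_kη_i → A_i(t)η_i(t) - ∫₀ᵗ η_i A_i'`
by summation by parts and the convergence of tagged Riemann–Stieltjes sums (every path), and
`∑ η_i(s_k)Δ_kη_i = (η_i(t)² - ∑(Δ_kη_i)²)/2 → (η_i(t)² - σ_i² t)/2` by the almost sure dyadic quadratic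
variation of the two Brownian motions (for `N ≥ 2` each `η_i` carries at most one of them).
[cite: CuneoEckmannHairerReyBellet2018, Lemma 5.5 (proof)] -/
theorem pinnedChain_ae_tendsto_discreteMart (hN : 1 < N) (hTL : 0 ≤ T_L) (hTR : 0 ≤ T_R) {t : ℝ} (ht : 0 ≤ t)
    (x : PhaseSpace N) :
    ∀ᵐ ω ∂wienerPair, Tendsto (fun m : ℕ =>
      (pinnedChain ω₂ lam β γ).discreteMart N T_L T_R (t / 2 ^ m) (2 ^ m) x (pairPath ω)) atTop
      (𝓝 ((pinnedChain ω₂ lam β γ).energyMart N T_L T_R t x (pairPath ω))) := by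
  set P := pinnedChain ω₂ lam β γ with hP
  set cL := Real.sqrt (2 * P.γ * T_L) with hcL
  set cR := Real.sqrt (2 * P.γ * T_R) with hcR
  have hγ' : P.γ = γ := rfl
  have hcL2 : cL ^ 2 = 2 * P.γ * T_L := Real.sq_sqrt (by rw [hγ']; positivity)
  have hcR2 : cR ^ 2 = 2 * P.γ * T_R := Real.sq_sqrt (by rw [hγ']; positivity)
  filter_upwards [ae_tendsto_brownianQuadSum_dyadic_pair t.toNNReal] with ω hω
  obtain ⟨hω1, hω2⟩ := hω
  -- notation along the path
  set η : ℝ → Fin N → ℝ := P.pairNoise N T_L T_R (pairPath ω) with hη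
  set z : ℝ → PhaseSpace N := fun s => P.solMap N T_L T_R s x (pairPath ω) with hz
  have hzflow : ∀ s, z s = P.chainFlow N x η s := fun s => rfl
  have hηc : Continuous η := P.continuous_pairNoise N T_L T_R _
  have hzc : Continuous z := pinnedChain_continuous_solMap hω hl hβ hγ N T_L T_R x (pairPath ω)
  set Y := P.drift N with hY
  have hYc : Continuous Y := (pinnedChain_contDiff_drift ω₂ lam β γ N (n := 0)).continuous
  -- the `C¹` part of the momentum: `A_i(s) = p_i(s) - η_i(s) = x_{p,i} + ∫₀ˢ Y(z)_{p,i}` on `[0, ∞)`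
  have hA : ∀ (i : Fin N) {s : ℝ}, 0 ≤ s → (z s).2 i - η s i = x.2 i + ∫ r in (0 : ℝ)..s, (Y (z r)).2 i := by
    intro i s hs
    have h := pinnedChain_chainFlow_sub_sub_eq_integral hω hl hβ hγ N x hηc (T := s) (t := s) ⟨hs, le_rfl⟩
    have hL := ((ContinuousLinearMap.proj i : (Fin N → ℝ) →L[ℝ] ℝ).comp
      (ContinuousLinearMap.snd ℝ (Fin N → ℝ) (Fin N → ℝ))).intervalIntegral_comp_comm
      ((hYc.comp hzc).intervalIntegrable (μ := volume) 0 s)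
    simp only [ContinuousLinearMap.coe_comp, Function.comp_apply, ContinuousLinearMap.coe_snd',
      ContinuousLinearMap.proj_apply] at hL
    have h2 := congrArg (fun v : PhaseSpace N => v.2 i) h
    simp only [Prod.snd_sub, Pi.sub_apply] at h2
    have h3 : (z s).2 i - x.2 i - η s i = (∫ r in (0 : ℝ)..s, Y (z r)).2 i := h2
    rw [← hL] at h3
    linarith
  -- per component and per `n ≥ 1`: the decomposition of the Itô sum
  have hdecomp : ∀ (i : Fin N) (n : ℕ), n ≠ 0 →
      ∑ k ∈ range n, (z (k * (t / n))).2 i * (η ((k + 1) * (t / n)) i - η (k * (t / n)) i) =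
        (((z t).2 i - η t i) * η t i -
          ∑ k ∈ range n, η ((k + 1) * (t / n)) i * ∫ r in (k * (t / n))..((k + 1) * (t / n)), (Y (z r)).2 i) +
        (η t i ^ 2 - ∑ k ∈ range n, (η ((k + 1) * (t / n)) i - η (k * (t / n)) i) ^ 2) / 2 := by
    intro i n hn
    have hnr : (n : ℝ) ≠ 0 := Nat.cast_ne_zero.2 hn
    set A : ℕ → ℝ := fun k => (z (k * (t / n))).2 i - η (k * (t / n)) i with hAdef
    set e : ℕ → ℝ := fun k => η (k * (t / n)) i with hedef
    have hci : Continuous fun r => (Y (z r)).2 i := (continuous_apply i).comp (continuous_snd.comp (hYc.comp hzc))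
    have hterm : ∀ k : ℕ, (z (k * (t / n))).2 i * (η ((k + 1) * (t / n)) i - η (k * (t / n)) i) =
        A k * (e (k + 1) - e k) + e k * (e (k + 1) - e k) := fun k => by
      simp only [hAdef, hedef, Nat.cast_succ]; ring
    have hn' : (n : ℝ) * (t / n) = t := mul_div_cancel₀ _ hnr
    have hAn : A n = (z t).2 i - η t i := by simp [hAdef, hn']
    have hen : e n = η t i := by simp [hedef, hn']
    have he0 : e 0 = 0 := by simp [hedef, hη]
    have hAdiff : ∀ k : ℕ, A (k + 1) - A k = ∫ r in (k * (t / n))..((k + 1) * (t / n)), (Y (z r)).2 i := by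
      intro k
      have hk0 : (0 : ℝ) ≤ k * (t / n) := by positivity
      have hk1 : (0 : ℝ) ≤ (k + 1) * (t / n) := by positivity
      have e1 : A (k + 1) = x.2 i + ∫ r in (0 : ℝ)..((k + 1) * (t / n)), (Y (z r)).2 i := by
        simp only [hAdef, Nat.cast_succ]; exact hA i hk1
      have e0 : A k = x.2 i + ∫ r in (0 : ℝ)..(k * (t / n)), (Y (z r)).2 i := hA i hk0
      rw [e1, e0, add_sub_add_left_eq_sub,
        intervalIntegral.integral_interval_sub_left (hci.intervalIntegrable _ _) (hci.intervalIntegrable _ _)]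
    rw [sum_congr rfl fun k _ => hterm k, sum_add_distrib, sum_mul_sub_eq_abel A e n, sum_mul_sub_self_eq e n]
    simp_rw [hAdiff]
    rw [hAn, hen, he0]
    simp only [hedef, Nat.cast_succ, mul_zero, sub_zero]
    ring
  -- (a) the Riemann–Stieltjes part converges for every path
  have hRS : ∀ i : Fin N, Tendsto (fun n : ℕ => ∑ k ∈ range n,
      η ((k + 1) * (t / n)) i * ∫ r in (k * (t / n))..((k + 1) * (t / n)), (Y (z r)).2 i) atTop
      (𝓝 (∫ s in (0 : ℝ)..t, η s i * (Y (z s)).2 i)) := fun i =>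
    tendsto_sum_mul_integral_of_continuous ((continuous_apply i).comp hηc)
      ((continuous_apply i).comp (continuous_snd.comp (hYc.comp hzc))) ht (fun n k => ((k : ℝ) + 1) * (t / n))
      fun n k _ => ⟨mul_le_mul_of_nonneg_right (by linarith) (by positivity), le_rfl⟩
  -- (b) the quadratic sums of the noise converge almost surely (here: on the good event)
  have hQ : ∀ i : Fin N, Tendsto (fun m : ℕ => ∑ k ∈ range (2 ^ m),
      (η ((k + 1) * (t / 2 ^ m)) i - η (k * (t / 2 ^ m)) i) ^ 2) atTop (𝓝 (P.noiseVar N T_L T_R i * t)) := by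
    intro i
    set a : ℝ := if i.val = 0 then cL else 0 with ha
    set b : ℝ := if i.val = N - 1 then cR else 0 with hb
    have hab : a * b = 0 := by
      simp only [ha, hb]
      split_ifs with h1 h2
      · exfalso; omega
      · simp
      · simp
      · simp
    have hηab : ∀ s : ℝ, η s i = a * brownian s.toNNReal ω.1 + b * brownian s.toNNReal ω.2 := fun s => by
      simp only [hη, P.pairNoise_pairPath, ha, hb, hcL, hcR]
    have hsq : ∀ m : ℕ, ∑ k ∈ range (2 ^ m), (η ((k + 1) * (t / 2 ^ m)) i - η (k * (t / 2 ^ m)) i) ^ 2 =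
        a ^ 2 * brownianQuadSum t.toNNReal (2 ^ m) ω.1 + b ^ 2 * brownianQuadSum t.toNNReal (2 ^ m) ω.2 := by
      intro m
      unfold brownianQuadSum
      rw [mul_sum, mul_sum, ← sum_add_distrib]
      refine sum_congr rfl fun k _ => ?_
      have h1 : (((k : ℝ) + 1) * (t / 2 ^ m)).toNNReal = gridTime t.toNNReal (2 ^ m) (k + 1) := by
        have := toNNReal_mul_div_eq_gridTime ht (2 ^ m) (k + 1)
        push_cast at this ⊢
        exact this
      have h0 : ((k : ℝ) * (t / 2 ^ m)).toNNReal = gridTime t.toNNReal (2 ^ m) k := by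
        have := toNNReal_mul_div_eq_gridTime ht (2 ^ m) k
        push_cast at this ⊢
        exact this
      rw [hηab, hηab, h1, h0]
      have key : ∀ u v u' v' : ℝ, (a * u + b * v - (a * u' + b * v')) ^ 2 =
          a ^ 2 * (u - u') ^ 2 + b ^ 2 * (v - v') ^ 2 + 2 * (a * b) * ((u - u') * (v - v')) := fun u v u' v' => by ring
      rw [key, hab]
      ring
    simp_rw [hsq]
    have hva : P.noiseVar N T_L T_R i = a ^ 2 + b ^ 2 := by
      simp only [OscillatorChain.noiseVar, ha, hb]
      split_ifs <;> simp [hcL2, hcR2]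
    have hvar : P.noiseVar N T_L T_R i * t = a ^ 2 * t + b ^ 2 * t := by rw [hva]; ring
    rw [hvar]
    have ht' : ((t.toNNReal : ℝ≥0) : ℝ) = t := Real.coe_toNNReal t ht
    rw [ht'] at hω1 hω2
    exact (hω1.const_mul _).add (hω2.const_mul _)
  -- assemble: swap the sums and pass to the limit componentwise
  have hswap : ∀ m : ℕ, P.discreteMart N T_L T_R (t / 2 ^ m) (2 ^ m) x (pairPath ω) =
      ∑ i, ∑ k ∈ range (2 ^ m), (z (k * (t / 2 ^ m))).2 i *
        (η ((k + 1) * (t / 2 ^ m)) i - η (k * (t / 2 ^ m)) i) := by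
    intro m
    unfold OscillatorChain.discreteMart
    rw [sum_comm]
  simp_rw [hswap]
  have hgoal : P.energyMart N T_L T_R t x (pairPath ω) =
      ∑ i, ((((z t).2 i - η t i) * η t i - ∫ s in (0 : ℝ)..t, η s i * (Y (z s)).2 i) +
        (η t i ^ 2 - P.noiseVar N T_L T_R i * t) / 2) := by
    unfold OscillatorChain.energyMart
    rw [Finset.sum_mul, Finset.sum_div, OscillatorChain.noiseWork, ← Finset.sum_sub_distrib]
    refine sum_congr rfl fun i _ => ?_
    simp only [hz, hη, hY, OscillatorChain.solMap_eq_chainFlow]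
    ring
  rw [hgoal]
  refine tendsto_finsetSum _ fun i _ => ?_
  have h2m : ∀ m : ℕ, (2 : ℕ) ^ m ≠ 0 := fun m => pow_ne_zero m two_ne_zero
  have hdec' : ∀ m : ℕ, ∑ k ∈ range (2 ^ m), (z (k * (t / 2 ^ m))).2 i *
      (η ((k + 1) * (t / 2 ^ m)) i - η (k * (t / 2 ^ m)) i) =
      (((z t).2 i - η t i) * η t i -
          ∑ k ∈ range (2 ^ m), η ((k + 1) * (t / 2 ^ m)) i * ∫ r in (k * (t / 2 ^ m))..((k + 1) * (t / 2 ^ m)), (Y (z r)).2 i) +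
        (η t i ^ 2 - ∑ k ∈ range (2 ^ m), (η ((k + 1) * (t / 2 ^ m)) i - η (k * (t / 2 ^ m)) i) ^ 2) / 2 := by
    intro m
    have := hdecomp i (2 ^ m) (h2m m)
    push_cast at this
    exact this
  simp_rw [hdec']
  have hpow : Tendsto (fun m : ℕ => (2 : ℕ) ^ m) atTop atTop := tendsto_pow_atTop_atTop_of_one_lt one_lt_two
  have hRS' : Tendsto (fun m : ℕ => ∑ k ∈ range (2 ^ m),
      η ((k + 1) * (t / 2 ^ m)) i * ∫ r in (k * (t / 2 ^ m))..((k + 1) * (t / 2 ^ m)), (Y (z r)).2 i) atTop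
      (𝓝 (∫ s in (0 : ℝ)..t, η s i * (Y (z s)).2 i)) := by
    have := (hRS i).comp hpow
    refine this.congr fun m => ?_
    simp only [Function.comp_apply]
    push_cast
    rfl
  exact (tendsto_const_nhds.sub hRS').add ((tendsto_const_nhds.sub (hQ i)).div_const 2)

end Limit

/-! ### The exponential supermartingale bound and its energy form -/

section ExpMart

variable {ω₂ lam β γ : ℝ} (hω : 0 < ω₂) (hl : 0 ≤ lam) (hβ : 0 ≤ β) (hγ : 0 ≤ γ) (N : ℕ)
  {T_L T_R : ℝ} (hTL : 0 ≤ T_L) (hTR : 0 ≤ T_R)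
include hω hl hβ hγ

/-- `M_t` is a measurable functional of the Brownian pair. [folklore] -/
theorem pinnedChain_measurable_energyMart (t : ℝ) (x : PhaseSpace N) :
    Measurable fun ω => (pinnedChain ω₂ lam β γ).energyMart N T_L T_R t x (pairPath ω) := by
  unfold OscillatorChain.energyMart
  refine Measurable.sub ?_ measurable_const
  exact pinnedChain_measurable_noiseWork hω hl hβ hγ N (X := fun _ : WienerPair => x) measurable_const
    (G := fun ω => (pinnedChain ω₂ lam β γ).pairNoise N T_L T_R (pairPath ω))
    (fun _ => (pinnedChain ω₂ lam β γ).continuous_pairNoise N T_L T_R _)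
    (fun u => ((pinnedChain ω₂ lam β γ).measurable_pairNoise N T_L T_R u).comp measurable_pairPath) t

/-- `[M]_t` is a measurable functional of the Brownian pair. [folklore] -/
theorem pinnedChain_measurable_energyQV (t : ℝ) (x : PhaseSpace N) :
    Measurable fun ω => (pinnedChain ω₂ lam β γ).energyQV N T_L T_R t x (pairPath ω) := by
  unfold OscillatorChain.energyQV
  refine Finset.measurable_sum _ fun i _ => Measurable.const_mul ?_ _
  refine measurable_intervalIntegral_of_continuous_of_measurable (fun ω => ?_) (fun s => ?_) t
  · exact ((continuous_apply i).comp (continuous_snd.comp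
      (pinnedChain_continuous_solMap hω hl hβ hγ N T_L T_R x (pairPath ω)))).pow 2
  · exact ((measurable_pi_apply i).comp (measurable_snd.comp
      (pinnedChain_measurable_solMap_pairPath_right hω hl hβ hγ N T_L T_R s x))).pow_const 2

/-- `Γ_t` is a measurable functional of the Brownian pair. [folklore] -/
theorem pinnedChain_measurable_dissipation_pairPath (t : ℝ) (x : PhaseSpace N) :
    Measurable fun ω => (pinnedChain ω₂ lam β γ).dissipation N x
      ((pinnedChain ω₂ lam β γ).pairNoise N T_L T_R (pairPath ω)) t :=
  pinnedChain_measurable_dissipation hω hl hβ hγ N (X := fun _ : WienerPair => x) measurable_const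
    (G := fun ω => (pinnedChain ω₂ lam β γ).pairNoise N T_L T_R (pairPath ω))
    (fun _ => (pinnedChain ω₂ lam β γ).continuous_pairNoise N T_L T_R _)
    (fun u => ((pinnedChain ω₂ lam β γ).measurable_pairNoise N T_L T_R u).comp measurable_pairPath) t

include hTL hTR in
/-- **The exponential supermartingale bound** (CEHR, proof of Lemma 5.5: "the exponential there is a
Doléans–Dade exponential, and thus a supermartingale"): for the martingale part `M_t` of the energy
of the pinned chain (`N ≥ 2`) and its quadratic variation `[M]_t`,
`E_x exp(α M_t - α² [M]_t / 2) ≤ 1` for every `α`, `t ≥ 0`, `x`. Proof: Fatou along the dyadic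
Riemann–Itô sums, whose exponentials have expectation exactly one.
[cite: CuneoEckmannHairerReyBellet2018, Lemma 5.5] -/
theorem pinnedChain_lintegral_expMart_le_one (hN : 1 < N) (α : ℝ) {t : ℝ} (ht : 0 ≤ t) (x : PhaseSpace N) :
    ∫⁻ ω, ENNReal.ofReal (Real.exp (α * (pinnedChain ω₂ lam β γ).energyMart N T_L T_R t x (pairPath ω) -
        α ^ 2 / 2 * (pinnedChain ω₂ lam β γ).energyQV N T_L T_R t x (pairPath ω))) ∂wienerPair ≤ 1 := by
  set P := pinnedChain ω₂ lam β γ with hP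
  set F : ℕ → WienerPair → ℝ≥0∞ := fun m ω => ENNReal.ofReal (Real.exp
    (α * P.discreteMart N T_L T_R (t / 2 ^ m) (2 ^ m) x (pairPath ω) -
      α ^ 2 / 2 * P.discreteQV N T_L T_R (t / 2 ^ m) (2 ^ m) x (pairPath ω))) with hF
  have hFm : ∀ m, Measurable (F m) := fun m =>
    ENNReal.measurable_ofReal.comp (Real.measurable_exp.comp
      ((((pinnedChain_measurable_discreteMart hω hl hβ hγ N _ _).comp
        (measurable_const.prodMk measurable_pairPath)).const_mul _).sub
        (((pinnedChain_measurable_discreteQV hω hl hβ hγ N _ _).comp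
        (measurable_const.prodMk measurable_pairPath)).const_mul _)))
  have hF1 : ∀ m, ∫⁻ ω, F m ω ∂wienerPair = 1 := fun m =>
    pinnedChain_lintegral_exp_discreteMart_eq_one hω hl hβ hγ N hTL hTR (by omega) α
      (h := t / 2 ^ m) (by positivity) (2 ^ m) x
  have hpow : Tendsto (fun m : ℕ => (2 : ℕ) ^ m) atTop atTop := tendsto_pow_atTop_atTop_of_one_lt one_lt_two
  have hlim : ∀ᵐ ω ∂wienerPair, Tendsto (fun m => F m ω) atTop (𝓝 (ENNReal.ofReal (Real.exp
      (α * P.energyMart N T_L T_R t x (pairPath ω) - α ^ 2 / 2 * P.energyQV N T_L T_R t x (pairPath ω))))) := by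
    filter_upwards [pinnedChain_ae_tendsto_discreteMart hω hl hβ hγ N T_L T_R hN hTL hTR ht x] with ω hωlim
    have hQ : Tendsto (fun m : ℕ => P.discreteQV N T_L T_R (t / 2 ^ m) (2 ^ m) x (pairPath ω)) atTop
        (𝓝 (P.energyQV N T_L T_R t x (pairPath ω))) := by
      have := (pinnedChain_tendsto_discreteQV hω hl hβ hγ N T_L T_R ht x (pairPath ω)).comp hpow
      refine this.congr fun m => ?_
      simp only [Function.comp_apply]
      push_cast
      rfl
    exact (ENNReal.continuous_ofReal.tendsto _).comp ((Real.continuous_exp.tendsto _).comp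
      ((hωlim.const_mul α).sub (hQ.const_mul _)))
  calc ∫⁻ ω, ENNReal.ofReal (Real.exp (α * P.energyMart N T_L T_R t x (pairPath ω) -
          α ^ 2 / 2 * P.energyQV N T_L T_R t x (pairPath ω))) ∂wienerPair
      = ∫⁻ ω, liminf (fun m => F m ω) atTop ∂wienerPair :=
        lintegral_congr_ae (hlim.mono fun ω hωlim => hωlim.liminf_eq.symm)
    _ ≤ liminf (fun m => ∫⁻ ω, F m ω ∂wienerPair) atTop := lintegral_liminf_le hFm
    _ = 1 := by simp only [hF1, liminf_const]

include hTL hTR in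
/-- **The energy form of the exponential bound** (the estimate behind CEHR (5.11) and (5.14)):
for every real `θ`, with `T_max = max(T_L, T_R)` and `κ = θ(1 - θ T_max)` (positive when
`0 < θ < 1/T_max`), `E_x exp(θ H(z_t) + κ Γ_t) ≤ exp(θ H(x) + θγ(T_L + T_R) t)` — the energy
identity `H(z_t) = H(x) + M_t + γ(T_L+T_R)t - Γ_t`, the bound `[M]_t ≤ 2 T_max Γ_t` (5.12), and
`E exp(θM_t - θ²[M]_t/2) ≤ 1`: the dissipation `Γ_t` is exponentially integrable jointly with
`e^{θH(z_t)}`. [cite: CuneoEckmannHairerReyBellet2018, Lemma 5.5, eqs. (5.11)–(5.12)] -/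
theorem pinnedChain_lintegral_exp_hamiltonian_add_dissipation_le (hN : 1 < N) (θ : ℝ) {t : ℝ} (ht : 0 ≤ t)
    (x : PhaseSpace N) :
    ∫⁻ ω, ENNReal.ofReal (Real.exp (θ * (pinnedChain ω₂ lam β γ).hamiltonian N
        ((pinnedChain ω₂ lam β γ).solMap N T_L T_R t x (pairPath ω)) +
        θ * (1 - θ * max T_L T_R) * (pinnedChain ω₂ lam β γ).dissipation N x
          ((pinnedChain ω₂ lam β γ).pairNoise N T_L T_R (pairPath ω)) t)) ∂wienerPair ≤
      ENNReal.ofReal (Real.exp (θ * (pinnedChain ω₂ lam β γ).hamiltonian N x + θ * γ * (T_L + T_R) * t)) := by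
  set P := pinnedChain ω₂ lam β γ with hP
  have hγ' : P.γ = γ := rfl
  -- the pointwise bound on the exponent
  have hpt : ∀ ω : WienerPair,
      θ * P.hamiltonian N (P.solMap N T_L T_R t x (pairPath ω)) +
        θ * (1 - θ * max T_L T_R) * P.dissipation N x (P.pairNoise N T_L T_R (pairPath ω)) t ≤
      (θ * P.hamiltonian N x + θ * γ * (T_L + T_R) * t) +
        (θ * P.energyMart N T_L T_R t x (pairPath ω) - θ ^ 2 / 2 * P.energyQV N T_L T_R t x (pairPath ω)) := by
    intro ω
    set η := P.pairNoise N T_L T_R (pairPath ω) with hη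
    have hηc : Continuous η := P.continuous_pairNoise N T_L T_R _
    -- energy identity
    have hE := pinnedChain_hamiltonian_chainFlow_eq hω hl hβ hγ N x hηc ht
    rw [← P.solMap_eq_chainFlow] at hE
    -- `noiseWork = M + γ(T_L + T_R) t`
    have hM : P.noiseWork N x η t = P.energyMart N T_L T_R t x (pairPath ω) + γ * (T_L + T_R) * t := by
      unfold OscillatorChain.energyMart
      rw [P.sum_noiseVar (by omega), hγ']
      ring
    -- `[M]_t ≤ 2 T_max Γ_t`
    have hQ : P.energyQV N T_L T_R t x (pairPath ω) ≤ 2 * max T_L T_R * P.dissipation N x η t := by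
      unfold OscillatorChain.energyQV OscillatorChain.dissipation
      change _ ≤ 2 * max T_L T_R * (P.γ * ∫ s in (0 : ℝ)..t, ∑ i, bathWeight N i *
        (P.solMap N T_L T_R s x (pairPath ω)).2 i ^ 2)
      have hzc := pinnedChain_continuous_solMap hω hl hβ hγ N T_L T_R x (pairPath ω)
      have hci : ∀ i, Continuous fun s => (P.solMap N T_L T_R s x (pairPath ω)).2 i ^ 2 := fun i =>
        ((continuous_apply i).comp (continuous_snd.comp hzc)).pow 2
      have hint : ∫ s in (0 : ℝ)..t, ∑ i, bathWeight N i * (P.solMap N T_L T_R s x (pairPath ω)).2 i ^ 2 =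
          ∑ i, bathWeight N i * ∫ s in (0 : ℝ)..t, (P.solMap N T_L T_R s x (pairPath ω)).2 i ^ 2 := by
        rw [intervalIntegral.integral_finsetSum fun i _ => ((hci i).const_mul _ :
          Continuous fun s => bathWeight N i * (P.solMap N T_L T_R s x (pairPath ω)).2 i ^ 2).intervalIntegrable _ _]
        refine sum_congr rfl fun i _ => ?_
        rw [intervalIntegral.integral_const_mul]
      rw [hint, mul_sum, mul_sum]
      refine sum_le_sum fun i _ => ?_
      have hI0 : 0 ≤ ∫ s in (0 : ℝ)..t, (P.solMap N T_L T_R s x (pairPath ω)).2 i ^ 2 :=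
        intervalIntegral.integral_nonneg ht fun s _ => sq_nonneg _
      have hv := P.noiseVar_le (show 0 ≤ P.γ from hγ) T_L T_R i
      calc P.noiseVar N T_L T_R i * ∫ s in (0 : ℝ)..t, (P.solMap N T_L T_R s x (pairPath ω)).2 i ^ 2
          ≤ (2 * P.γ * max T_L T_R * bathWeight N i) * ∫ s in (0 : ℝ)..t, (P.solMap N T_L T_R s x (pairPath ω)).2 i ^ 2 :=
            mul_le_mul_of_nonneg_right hv hI0
        _ = 2 * max T_L T_R * (P.γ * (bathWeight N i * ∫ s in (0 : ℝ)..t, (P.solMap N T_L T_R s x (pairPath ω)).2 i ^ 2)) := by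
            ring
    have hΓ0 : 0 ≤ P.dissipation N x η t := pinnedChain_dissipation_nonneg hω hl hβ hγ N x hηc ht
    -- combine
    rw [hE, hM]
    have h1 : θ ^ 2 / 2 * P.energyQV N T_L T_R t x (pairPath ω) ≤ θ ^ 2 * max T_L T_R * P.dissipation N x η t := by
      have := mul_le_mul_of_nonneg_left hQ (by positivity : 0 ≤ θ ^ 2 / 2)
      linarith
    nlinarith [h1, hΓ0]
  -- integrate
  have hmeas : Measurable fun ω => ENNReal.ofReal (Real.exp (θ * P.energyMart N T_L T_R t x (pairPath ω) -
      θ ^ 2 / 2 * P.energyQV N T_L T_R t x (pairPath ω))) :=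
    ENNReal.measurable_ofReal.comp (Real.measurable_exp.comp
      (((pinnedChain_measurable_energyMart hω hl hβ hγ N t x).const_mul _).sub
        ((pinnedChain_measurable_energyQV hω hl hβ hγ N t x).const_mul _)))
  calc ∫⁻ ω, ENNReal.ofReal (Real.exp (θ * P.hamiltonian N (P.solMap N T_L T_R t x (pairPath ω)) +
          θ * (1 - θ * max T_L T_R) * P.dissipation N x (P.pairNoise N T_L T_R (pairPath ω)) t)) ∂wienerPair
      ≤ ∫⁻ ω, ENNReal.ofReal (Real.exp (θ * P.hamiltonian N x + θ * γ * (T_L + T_R) * t)) *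
          ENNReal.ofReal (Real.exp (θ * P.energyMart N T_L T_R t x (pairPath ω) -
            θ ^ 2 / 2 * P.energyQV N T_L T_R t x (pairPath ω))) ∂wienerPair := by
        refine lintegral_mono fun ω => ?_
        rw [← ENNReal.ofReal_mul (Real.exp_pos _).le, ← Real.exp_add]
        exact ENNReal.ofReal_le_ofReal (Real.exp_le_exp.2 (hpt ω))
    _ = ENNReal.ofReal (Real.exp (θ * P.hamiltonian N x + θ * γ * (T_L + T_R) * t)) *
          ∫⁻ ω, ENNReal.ofReal (Real.exp (θ * P.energyMart N T_L T_R t x (pairPath ω) -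
            θ ^ 2 / 2 * P.energyQV N T_L T_R t x (pairPath ω))) ∂wienerPair :=
        lintegral_const_mul _ hmeas
    _ ≤ ENNReal.ofReal (Real.exp (θ * P.hamiltonian N x + θ * γ * (T_L + T_R) * t)) * 1 := by
        gcongr
        exact pinnedChain_lintegral_expMart_le_one hω hl hβ hγ N hTL hTR hN θ ht x
    _ = _ := mul_one _

end ExpMart

end Literature.MathematicalPhysics.KineticTheory.HeatConduction
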